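import Mathlib
import Summits.NavierStokesRegularity.NavierStokesRegularity.Theorems.EulerZoomLiouvillePowerGaugeEulerLiouvilleSelfSimilarBernoulliFeeding
import Summits.NavierStokesRegularity.NavierStokesRegularity.Theorems.EulerZoomLiouvillePowerGaugeEulerLiouvilleSelfSimilarBernoulliLandscape
import Summits.NavierStokesRegularity.NavierStokesRegularity.Theorems.EulerZoomLiouvillePowerGaugeEulerLiouvilleSelfSimilarBackwardEscape
import HarnessLib

/-!
# «SUPER-FAST CHANNELS SQUEEZE VOLUME TOO FAST» — the (C2) volume-squeeze assembly for THE ONE STATEMENT of the crux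
# `EulerZoomLiouville.PowerGaugeEulerLiouville` (stmt-NavierStokesRegularity-19832), parametrised by the thinness rate of the high Bernoulli set

Route №10 `EulerZoomLiouville` (NavierStokesRegularity), crux E, line `birth`, THE ONE STATEMENT (`stub_selfSimilarC2Needle`): a `C²` in-window
self-similar Euler profile whose vorticity is fed from infinity through VORTICAL, BERNOULLI-HIGH fast-inflow points on every large sphere.  Width seat
ns-ezl-w5 g0; assembles the LEAD's RESIDUE-MEMO-19832-g11 §2 (C2) heuristic «unpressurised needles squeeze volume too fast» into a theorem, with the
thinness of the high set `Θ_h = {ℋ > h}` taken as an INPUT WITH A RATE `m` — so that the polynomial thinness of the tree (`…SelfSimilarBernoulliThinness`,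
`m = 1 + 2ρ` from the `A`-gauge) and any future super-polynomial (log-capacity) thinness plug into the same statement.

THE THEOREM (`Loc.curl_eq_zero_of_fastChannel_of_thin`).  Let `(U, P)` be a `C²` profile of CIV (3.3), `0 < γ < ½`, `W = γy + U`,
`ℋ = ½|W|² + P + ½γ(γ−1)|y|²`, with
* LINEAR GROWTH `‖U(y)‖ ≤ K₁(1 + ‖y‖)` (model class: backward orbits cannot reach infinity in finite time);
* a THIN HIGH SET with rate `m > 0`: for every level `h`, `vol(Θ_h ∩ {‖y‖ ≥ R}) ≤ C_h R^{−m}` for `R ≥ R₂(h)`;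
* a FAST CHANNEL of rate `c₁ > 0` on the far high set: for every `h` there is `R₀(h)` with `⟪y, W(y)⟫ ≤ −c₁‖y‖²` whenever `‖y‖ ≥ R₀(h)`, `ℋ(y) > h`
  (backward radial speed `≥ c₁‖y‖`; in the needle's language `s − γ ≥ c₁`);
* the EXPONENT RACE `c₁ m > 3γ`.
Then `curl U ≡ 0`.

PROOF.  If `curl U(x₀) ≠ 0`, `h := ℋ(x₀) − 1`: FEEDING FROM INFINITY (ezl-w6's `Loc.exists_fastInflow_vortical_bernoulli_gt`) gives a point of `Θ_h`
on a far sphere, hence an open BLOB `A ⊆ Θ_h ∩ {‖y‖ > R−1}`.  For `T ≥ 0`, cut `U` off outside a huge ball (`Loc.exists_cutoff_local_smul`) and follow the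
BACKWARD orbits of `A` under the cut-off similarity flow (`C2.Kelvin.hasDerivAt_flow_neg`): a first-exit argument (linear growth ⇒
`BackwardEscape.norm_le_mul_exp_of_inflow_ge` keeps them where the cut-off field IS the profile field; `ℋ` non-decreasing backward —
`Loc.selfSimilarBernoulli_monotone_backward` — keeps them in `Θ_h`; the channel gives `‖Y(t)‖ ≥ ‖y‖e^{c₁t}` — `BackwardEscape.norm_ge_mul_exp_of_fastInflow`)
shows `Φ_{−T}A ⊆ Θ_h ∩ {‖z‖ ≥ (R−1)e^{c₁T}}`, of volume `≤ C_h((R−1)e^{c₁T})^{−m}`, while the LOCALISED VOLUME LAW (the LEAD's (C1) tool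
`BernoulliLandscape.volume_image_flow_eq_exp_of_stay`) gives `vol A = e^{3γT} vol(Φ_{−T}A)`; so `vol A ≤ C_h(R−1)^{−m}e^{−(c₁m−3γ)T} → 0` — absurd.

HONEST LABEL: a model-class stratum, PARTIAL — with the tree's polynomial thinness `m = 1+2ρ` it kills SUPER-fast far channels
(`c₁ > 3γ/(1+2ρ) = 3/((2+ρ)(1+2ρ))`; RESIDUE-MEMO-g11: «c(1+2ρ) vs 3γ is not forced»); with a super-polynomial thinness input every `c₁ > 0` dies (take `m` large).
WHAT THIS IS NOT: not NS, not E — a tool/stratum for THE ONE STATEMENT `--supports` stmt-19832 (a statement about hypothetical `C²` self-similar Euler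
profiles); 19832 is a crux CLASS on the model lattice (E/NS strata) and stays OPEN; NS regularity is NOT proved.  [folklore; ConstantinIgnatovaVicol2026Putative
§3.4.1 (3.21)–(3.22), §3.4.3 (3.30)–(3.33)]
-/

noncomputable section

-- flat `Theorems/<Route><Decl>…` files of one crux share the namespace of the crux (tree convention)
set_option linter.dupNamespace false

open MeasureTheory Set Filter Topology Metric Function InnerProductSpace
open scoped RealInnerProductSpace NNReal ENNReal ContDiff

namespace Summit.NavierStokesRegularity.NavierStokesRegularity.Theorems.PowerGaugeEulerLiouville.Loc

open Literature.Analysis Literature.Analysis.FluidPDE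
open Summit.NavierStokesRegularity.NavierStokesRegularity.Theorems.PowerGaugeEulerLiouville.BernoulliLandscape
open Summit.NavierStokesRegularity.NavierStokesRegularity.Theorems.PowerGaugeEulerLiouville.BackwardEscape

variable {γ : ℝ} {U : EuclideanSpace ℝ (Fin 3) → EuclideanSpace ℝ (Fin 3)} {P : EuclideanSpace ℝ (Fin 3) → ℝ}

/-! ### Real-variable bookkeeping -/

/-- `((R−1)·e^{c₁T})^{−m} · e^{3γT} = (R−1)^{−m} · e^{(3γ − c₁m)T}`. [folklore] -/
theorem rpow_mul_exp_neg_mul_exp {a c₁ m γ T : ℝ} (ha : 0 < a) :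
    Real.exp (3 * γ * T) * (a * Real.exp (c₁ * T)) ^ (-m) = a ^ (-m) * Real.exp ((3 * γ - c₁ * m) * T) := by
  rw [Real.mul_rpow ha.le (Real.exp_pos _).le, ← Real.exp_mul,
    show (3 * γ - c₁ * m) * T = 3 * γ * T + c₁ * T * -m by ring, Real.exp_add]
  ring

/-- A quantity bounded by `K e^{−δT}` for every `T ≥ 0` (`δ > 0`) is `≤ ε` for every `ε > 0`. [folklore] -/
theorem exists_mul_exp_neg_lt {K δ ε : ℝ} (hδ : 0 < δ) (hε : 0 < ε) :
    ∃ T : ℝ, 0 ≤ T ∧ K * Real.exp (-(δ * T)) < ε := by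
  have h1 : Tendsto (fun T : ℝ => K * Real.exp (-(δ * T))) atTop (𝓝 (K * 0)) :=
    tendsto_const_nhds.mul (Real.tendsto_exp_atBot.comp (tendsto_neg_atTop_atBot.comp (tendsto_id.const_mul_atTop hδ)))
  rw [mul_zero] at h1
  exact ((eventually_ge_atTop (0 : ℝ)).and (h1.eventually (gt_mem_nhds hε))).exists.imp fun T hT => ⟨hT.1, hT.2⟩

/-! ### The squeeze -/

set_option maxHeartbeats 800000 in
/-- **SUPER-FAST CHANNELS SQUEEZE VOLUME TOO FAST.**  `(U, P)` a `C²` self-similar Euler profile (CIV (3.3)), `0 < γ < ½`, of linear growth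
`‖U y‖ ≤ K₁(1+‖y‖)`; every high set `Θ_h = {ℋ > h}` thin with rate `m` (`vol(Θ_h ∩ {‖y‖ ≥ R}) ≤ C_h R^{−m}` far out); a FAST CHANNEL
`⟪y, γy + U(y)⟫ ≤ −c₁‖y‖²` on the far part of every `Θ_h`; `c₁ m > 3γ`.  Then `U` is irrotational. [folklore; ConstantinIgnatovaVicol2026Putative §3.4] -/
theorem curl_eq_zero_of_fastChannel_of_thin (hprof : IsSelfSimilarEulerProfile γ 0 U P) (hγ : 0 < γ) (hγ2 : γ < 1 / 2)
    {K₁ : ℝ} (hK₁ : ∀ y : EuclideanSpace ℝ (Fin 3), ‖U y‖ ≤ K₁ * (1 + ‖y‖))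
    {m c₁ : ℝ} (hc₁ : 0 < c₁) (hrace : 3 * γ < c₁ * m)
    (hthin : ∀ h : ℝ, ∃ C R₂ : ℝ, 0 < R₂ ∧ ∀ R : ℝ, R₂ ≤ R →
      volume ({y : EuclideanSpace ℝ (Fin 3) | h < selfSimilarBernoulli γ 0 U P y} ∩ {y | R ≤ ‖y‖}) ≤
        ENNReal.ofReal (C * R ^ (-m)))
    (hfast : ∀ h : ℝ, ∃ R₀ : ℝ, ∀ y : EuclideanSpace ℝ (Fin 3), R₀ ≤ ‖y‖ → h < selfSimilarBernoulli γ 0 U P y →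
      ⟪y, selfSimilarTransport γ 0 U y⟫ ≤ -(c₁ * ‖y‖ ^ 2))
    (x₀ : EuclideanSpace ℝ (Fin 3)) : curl U x₀ = 0 := by
  by_contra hx₀
  set Hb : EuclideanSpace ℝ (Fin 3) → ℝ := selfSimilarBernoulli γ 0 U P with hHb
  have hHc : Continuous Hb := hprof.contDiff_selfSimilarBernoulli.continuous
  have hγ2' : γ ≤ 1 / 2 := hγ2.le
  have hK₁0 : 0 ≤ K₁ := by have := hK₁ 0; simp at this; exact (norm_nonneg _).trans this
  -- the level `h` and its radii
  set h : ℝ := Hb x₀ - 1 with hh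
  obtain ⟨C, R₂, hR₂, hthinR⟩ := hthin h
  obtain ⟨R₀, hfastR⟩ := hfast h
  -- WLOG `C ≥ 0`
  set C' : ℝ := max C 0 with hC'
  have hC'0 : 0 ≤ C' := le_max_right _ _
  have hthinR' : ∀ R : ℝ, R₂ ≤ R →
      volume ({y : EuclideanSpace ℝ (Fin 3) | h < Hb y} ∩ {y | R ≤ ‖y‖}) ≤ ENNReal.ofReal (C' * R ^ (-m)) :=
    fun R hR => (hthinR R hR).trans (ENNReal.ofReal_le_ofReal
      (mul_le_mul_of_nonneg_right (le_max_left _ _) (Real.rpow_nonneg (hR₂.le.trans hR) _)))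
  -- a radius beyond everything
  set R : ℝ := max (max R₀ R₂) (max ‖x₀‖ 1) + 1 with hRdef
  have hRR₀ : R₀ ≤ R - 1 := by rw [hRdef]; linarith [le_max_left R₀ R₂, le_max_left (max R₀ R₂) (max ‖x₀‖ 1)]
  have hRR₂ : R₂ ≤ R - 1 := by rw [hRdef]; linarith [le_max_right R₀ R₂, le_max_left (max R₀ R₂) (max ‖x₀‖ 1)]
  have hR1 : 1 ≤ R - 1 := by rw [hRdef]; linarith [le_max_right ‖x₀‖ 1, le_max_right (max R₀ R₂) (max ‖x₀‖ 1)]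
  have hRx₀ : ‖x₀‖ < R := by rw [hRdef]; linarith [le_max_left ‖x₀‖ 1, le_max_right (max R₀ R₂) (max ‖x₀‖ 1)]
  have hR0 : 0 < R - 1 := by linarith
  -- ### feeding from infinity: a far point of `Θ_h`, and an open blob around it
  have hhx₀ : h < Hb x₀ := by rw [hh]; linarith
  obtain ⟨y₀, hy₀R, -, -, hy₀h⟩ := exists_fastInflow_vortical_bernoulli_gt hprof hγ hγ2 hx₀ hhx₀ hRx₀
  have hO : IsOpen {y : EuclideanSpace ℝ (Fin 3) | h < Hb y} := isOpen_lt continuous_const hHc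
  obtain ⟨ε, hε, hεsub⟩ := Metric.isOpen_iff.1 hO y₀ hy₀h
  set r : ℝ := min ε 1 / 2 with hr
  have hr0 : 0 < r := by rw [hr]; positivity
  have hrε : r < ε := by rw [hr]; linarith [min_le_left ε 1]
  have hr1 : r < 1 := by rw [hr]; linarith [min_le_right ε 1]
  set A : Set (EuclideanSpace ℝ (Fin 3)) := ball y₀ r with hA
  have hAm : MeasurableSet A := measurableSet_ball
  have hAh : ∀ y ∈ A, h < Hb y := fun y hy => hεsub (ball_subset_ball hrε.le hy)
  have hAR : ∀ y ∈ A, R - 1 < ‖y‖ := fun y hy => by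
    have h1 : ‖y₀‖ - ‖y‖ ≤ ‖y₀ - y‖ := norm_sub_norm_le y₀ y
    rw [hA, mem_ball] at hy; rw [← dist_eq_norm, dist_comm] at h1; linarith
  have hApos : 0 < volume A := measure_ball_pos volume y₀ hr0
  have hAtop : volume A < ⊤ := measure_ball_lt_top
  -- ### the squeeze: for every `T ≥ 0`, `vol A ≤ C' (R−1)^{−m} e^{(3γ − c₁ m)T}`
  have hsqueeze : ∀ T : ℝ, 0 ≤ T →
      volume A ≤ ENNReal.ofReal (C' * (R - 1) ^ (-m) * Real.exp ((3 * γ - c₁ * m) * T)) := by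
    intro T hT
    -- the cut-off field
    set C₁ : ℝ := 2 * K₁ with hC₁
    set Rbig : ℝ := (R + 1) * Real.exp (C₁ * T) + 2 with hRbig
    have hRbig0 : 0 < Rbig := by rw [hRbig]; positivity
    obtain ⟨V, hV2, ⟨M, hM⟩, hsmul, ⟨K, hK⟩, hVU⟩ := exists_cutoff_local_smul hprof.contDiff_velocity hRbig0
    have hV1 : ContDiff ℝ 1 V := hV2.of_le (by norm_num)
    have hVlin : ∀ y, ‖V y‖ ≤ K₁ * (1 + ‖y‖) := by
      intro y
      obtain ⟨c, hc0, hc1, hcy⟩ := hsmul y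
      rw [hcy, norm_smul, Real.norm_of_nonneg hc0]
      exact (mul_le_of_le_one_left (norm_nonneg _) hc1).trans (hK₁ y)
    -- the backward orbits of the cut-off similarity flow
    set Φ : ℝ → EuclideanSpace ℝ (Fin 3) → EuclideanSpace ℝ (Fin 3) :=
      ODE.evolutionMap (fun _ : ℝ => selfSimilarTransport γ 0 V) 0 with hΦ
    have hflow_add : ∀ (s t : ℝ) (y : EuclideanSpace ℝ (Fin 3)), Φ (s + t) y = Φ s (Φ t y) :=
      fun s t y => C2.Kelvin.flow_add (γ := γ) hV1 hK s t y
    have hY : ∀ y t, HasDerivAt (fun r => Φ (-r) y) ((-1 : ℝ) • selfSimilarTransport γ 0 V (Φ (-t) y)) t :=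
      fun y t => C2.Kelvin.hasDerivAt_flow_neg (γ := γ) hV1 hK y t
    -- the cut-off field agrees with the profile field on the big ball
    have hWU : ∀ z : EuclideanSpace ℝ (Fin 3), ‖z‖ < Rbig → selfSimilarTransport γ 0 V z = selfSimilarTransport γ 0 U z := by
      intro z hz
      simp only [selfSimilarTransport_apply, hVU z (mem_ball_zero_iff.2 hz)]
    -- the slow bound for the cut-off field at radii ≥ 1
    have hslow : ∀ z : EuclideanSpace ℝ (Fin 3), 1 ≤ ‖z‖ → -(C₁ * ‖z‖ ^ 2) ≤ ⟪z, selfSimilarTransport γ 0 V z⟫ := by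
      intro z hz
      rw [selfSimilarTransport_apply, sub_zero, inner_add_right, real_inner_smul_right, real_inner_self_eq_norm_sq]
      have h1 : |⟪z, V z⟫| ≤ ‖z‖ * ‖V z‖ := abs_real_inner_le_norm _ _
      have h2 : ‖z‖ * ‖V z‖ ≤ ‖z‖ * (K₁ * (1 + ‖z‖)) := mul_le_mul_of_nonneg_left (hVlin z) (norm_nonneg _)
      have h3 : -⟪z, V z⟫ ≤ ‖z‖ * (K₁ * (1 + ‖z‖)) := (neg_le_abs _).trans (h1.trans h2)
      have h4 : ‖z‖ * (K₁ * (1 + ‖z‖)) ≤ 2 * K₁ * ‖z‖ ^ 2 := by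
        have h41 : K₁ * ‖z‖ * 1 ≤ K₁ * ‖z‖ * ‖z‖ :=
          mul_le_mul_of_nonneg_left hz (mul_nonneg hK₁0 (norm_nonneg z))
        nlinarith [h41]
      have h5 : 0 ≤ γ * ‖z‖ ^ 2 := by positivity
      rw [hC₁]
      linarith
    -- ORBIT CONTROL on `[0, T]`
    have horbit : ∀ y ∈ A, ∀ t ∈ Icc 0 T,
        ‖y‖ * Real.exp (c₁ * t) ≤ ‖Φ (-t) y‖ ∧ ‖Φ (-t) y‖ ≤ ‖y‖ * Real.exp (C₁ * t) ∧ h < Hb (Φ (-t) y) := by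
      intro y hy
      have hy1 : 1 ≤ ‖y‖ := hR1.trans (hAR y hy).le
      have hyR₀ : R₀ ≤ ‖y‖ := hRR₀.trans (hAR y hy).le
      have hyR1 : ‖y‖ ≤ R + 1 := by
        rw [hA, mem_ball] at hy
        have h1 : ‖y‖ - ‖y₀‖ ≤ ‖y - y₀‖ := norm_sub_norm_le y y₀
        rw [← dist_eq_norm] at h1
        linarith
      set Y : ℝ → EuclideanSpace ℝ (Fin 3) := fun t => Φ (-t) y with hYdef
      have hY0 : Y 0 = y := by simp [hYdef, hΦ, ODE.evolutionMap_self]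
      have hYc : Continuous Y := continuous_iff_continuousAt.2 fun t => (hY y t).continuousAt
      -- (i) what `good t` (the orbit has not come closer than `‖y‖` on `[0,t]`) buys
      have hgood : ∀ t, 0 ≤ t → t ≤ T → (∀ s ∈ Icc 0 t, ‖y‖ ≤ ‖Y s‖) →
          ∀ s ∈ Icc 0 t, ‖y‖ * Real.exp (c₁ * s) ≤ ‖Y s‖ ∧ ‖Y s‖ ≤ ‖y‖ * Real.exp (C₁ * s) ∧ h < Hb (Y s) ∧
            ⟪Y s, selfSimilarTransport γ 0 V (Y s)⟫ ≤ -(c₁ * ‖Y s‖ ^ 2) := by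
        intro t ht0 htT hg
        -- upper bound from the slow inequality
        have hup : ∀ s ∈ Icc 0 t, ‖Y s‖ ≤ ‖y‖ * Real.exp (C₁ * s) := by
          intro s hs
          have h1 := norm_le_mul_exp_of_inflow_ge (γ := γ) (V := V) (Y := Y) ht0
            (fun σ _ => hY y σ) (fun σ hσ => hslow (Y σ) (hy1.trans (hg σ hσ))) s hs
          simpa [hY0] using h1
        -- hence inside the big ball, where the cut-off field is the profile field
        have hin : ∀ s ∈ Icc 0 t, ‖Y s‖ < Rbig := by
          intro s hs
          have h1 : Real.exp (C₁ * s) ≤ Real.exp (C₁ * T) :=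
            Real.exp_le_exp.2 (mul_le_mul_of_nonneg_left (hs.2.trans htT) (by rw [hC₁]; positivity))
          have h2 : ‖y‖ * Real.exp (C₁ * s) ≤ (R + 1) * Real.exp (C₁ * T) :=
            mul_le_mul hyR1 h1 (Real.exp_pos _).le (by linarith)
          rw [hRbig]
          linarith [hup s hs]
        have hYU : ∀ s ∈ Icc 0 t, HasDerivAt Y ((-1 : ℝ) • selfSimilarTransport γ 0 U (Y s)) s := by
          intro s hs
          have h1 := hY y s
          rw [hWU _ (hin s hs)] at h1
          exact h1
        -- `ℋ` is non-decreasing along the (true) backward orbit: the orbit stays in `Θ_h`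
        have hH : ∀ s ∈ Icc 0 t, h < Hb (Y s) := by
          intro s hs
          have h1 := selfSimilarBernoulli_monotone_backward hprof hγ2' hs.1
            (fun σ hσ => hYU σ ⟨hσ.1, hσ.2.trans hs.2⟩)
          rw [hY0] at h1
          exact lt_of_lt_of_le (hAh y hy) h1
        -- the channel applies, and the orbit escapes
        have hch : ∀ s ∈ Icc 0 t, ⟪Y s, selfSimilarTransport γ 0 V (Y s)⟫ ≤ -(c₁ * ‖Y s‖ ^ 2) := by
          intro s hs
          rw [hWU _ (hin s hs)]
          exact hfastR (Y s) (hyR₀.trans (hg s hs)) (hH s hs)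
        have hlow : ∀ s ∈ Icc 0 t, ‖y‖ * Real.exp (c₁ * s) ≤ ‖Y s‖ := by
          intro s hs
          have h1 := norm_ge_mul_exp_of_fastInflow (γ := γ) (V := V) (Y := Y) ht0 (fun σ _ => hY y σ) hch s hs
          simpa [hY0] using h1
        exact fun s hs => ⟨hlow s hs, hup s hs, hH s hs, hch s hs⟩
      -- (ii) `good T` by a first-exit argument
      have hgoodT : ∀ s ∈ Icc 0 T, ‖y‖ ≤ ‖Y s‖ := by
        by_contra hbad
        push Not at hbad
        set B : Set ℝ := {s | s ∈ Icc 0 T ∧ ‖Y s‖ < ‖y‖} with hB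
        have hBne : B.Nonempty := by obtain ⟨s, hs, hlt⟩ := hbad; exact ⟨s, hs, hlt⟩
        have hBbdd : BddBelow B := ⟨0, fun s hs => hs.1.1⟩
        set t₀ : ℝ := sInf B with ht₀
        have ht₀mem : ∀ s ∈ B, t₀ ≤ s := fun s hs => csInf_le hBbdd hs
        have ht₀0 : 0 ≤ t₀ := le_csInf hBne fun s hs => hs.1.1
        have ht₀T : t₀ ≤ T := by obtain ⟨s, hs⟩ := hBne; exact (ht₀mem s hs).trans hs.1.2
        -- before `t₀` the orbit is good
        have hbefore : ∀ s ∈ Icc 0 T, s < t₀ → ‖y‖ ≤ ‖Y s‖ := by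
          intro s hs hst
          by_contra hlt
          exact absurd (ht₀mem s ⟨hs, not_le.1 hlt⟩) (not_le.2 hst)
        -- hence also at `t₀` (continuity), so `good t₀`
        have hgood₀ : ∀ s ∈ Icc 0 t₀, ‖y‖ ≤ ‖Y s‖ := by
          intro s hs
          rcases eq_or_lt_of_le hs.2 with heq | hlt
          · -- at `t₀` itself: limit from the left (or `t₀ = 0`)
            rw [heq]
            rcases eq_or_lt_of_le ht₀0 with h00 | h0pos
            · rw [← h00, hY0]
            · have hcl : ‖Y t₀‖ ∈ closure ((fun σ => ‖Y σ‖) '' Ico 0 t₀) := by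
                have hct : ContinuousWithinAt (fun σ => ‖Y σ‖) (Ico 0 t₀) t₀ :=
                  (hYc.norm.continuousAt).continuousWithinAt
                have hmem : t₀ ∈ closure (Ico 0 t₀) := by
                  rw [closure_Ico h0pos.ne]; exact right_mem_Icc.2 ht₀0
                exact hct.mem_closure_image hmem
              have hsub : (fun σ => ‖Y σ‖) '' Ico 0 t₀ ⊆ Ici ‖y‖ := by
                rintro _ ⟨σ, hσ, rfl⟩
                exact hbefore σ ⟨hσ.1, hσ.2.le.trans ht₀T⟩ hσ.2
              exact closure_mono hsub hcl |> fun hx => by rwa [closure_Ici, mem_Ici] at hx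
          · exact hbefore s ⟨hs.1, hlt.le.trans ht₀T⟩ hlt
        obtain ⟨hlow₀, -, -, hch₀⟩ := hgood t₀ ht₀0 ht₀T hgood₀ t₀ ⟨ht₀0, le_rfl⟩
        -- the strict channel inequality at `t₀` persists a little beyond `t₀`
        have hYt₀1 : 1 ≤ ‖Y t₀‖ := hy1.trans (hgood₀ t₀ ⟨ht₀0, le_rfl⟩)
        have hYt₀pos : 0 < ‖Y t₀‖ := by linarith
        have hcont : Continuous fun σ => ⟪Y σ, selfSimilarTransport γ 0 V (Y σ)⟫ + c₁ / 2 * ‖Y σ‖ ^ 2 := by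
          have hWc : Continuous (selfSimilarTransport γ 0 V) :=
            (PowerGaugeEulerLiouville.Kelvin.contDiff_selfSimilarTransport (γ := γ) hV1).continuous
          exact (hYc.inner (hWc.comp hYc)).add (continuous_const.mul (hYc.norm.pow 2))
        have hneg : ⟪Y t₀, selfSimilarTransport γ 0 V (Y t₀)⟫ + c₁ / 2 * ‖Y t₀‖ ^ 2 < 0 := by
          have : 0 < c₁ / 2 * ‖Y t₀‖ ^ 2 := by positivity
          linarith
        obtain ⟨δ, hδ, hδball⟩ := Metric.continuousAt_iff.1 hcont.continuousAt
          (-(⟪Y t₀, selfSimilarTransport γ 0 V (Y t₀)⟫ + c₁ / 2 * ‖Y t₀‖ ^ 2)) (by linarith)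
        have hch' : ∀ σ ∈ Icc t₀ (t₀ + δ / 2), ⟪Y σ, selfSimilarTransport γ 0 V (Y σ)⟫ ≤ -(c₁ / 2 * ‖Y σ‖ ^ 2) := by
          intro σ hσ
          have hd : dist σ t₀ < δ := by
            rw [Real.dist_eq, abs_of_nonneg (by linarith [hσ.1])]; linarith [hσ.2]
          have h1 := hδball hd
          rw [Real.dist_eq, abs_lt] at h1
          linarith [h1.2]
        have hesc : ∀ σ ∈ Icc t₀ (t₀ + δ / 2), ‖Y t₀‖ ≤ ‖Y σ‖ := by
          intro σ hσ
          have h1 := norm_ge_mul_exp_of_fastInflow (γ := γ) (V := V) (Y := Y) (c₁ := c₁ / 2) (by linarith : t₀ ≤ t₀ + δ / 2)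
            (fun σ' _ => hY y σ') hch' σ hσ
          have h2 : 1 ≤ Real.exp (c₁ / 2 * (σ - t₀)) := Real.one_le_exp (by nlinarith [hσ.1])
          nlinarith [norm_nonneg (Y t₀)]
        -- no bad time in `[t₀, t₀ + δ/2]`, none before `t₀`: contradiction with `t₀ = inf B`
        have hlb : ∀ s ∈ B, t₀ + δ / 2 ≤ s := by
          intro s hs
          by_contra hlt
          push Not at hlt
          have hst₀ : t₀ ≤ s := ht₀mem s hs
          have h1 : ‖y‖ ≤ ‖Y s‖ := (hgood₀ t₀ ⟨ht₀0, le_rfl⟩).trans (hesc s ⟨hst₀, hlt.le⟩)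
          exact absurd hs.2 (not_lt.2 h1)
        have : t₀ + δ / 2 ≤ t₀ := le_csInf hBne hlb
        linarith
      intro t ht
      obtain ⟨h1, h2, h3, -⟩ := hgood T hT le_rfl hgoodT t ht
      exact ⟨h1, h2, h3⟩
    -- ### the transported blob `B' = Φ_{−T} A = Φ_T ⁻¹' A`
    set B' : Set (EuclideanSpace ℝ (Fin 3)) := Φ T ⁻¹' A with hB'
    have hΦTc : Continuous (Φ T) := (C2.Kelvin.contDiff_flow (γ := γ) hV2 hK T).continuous
    have hB'm : MeasurableSet B' := hΦTc.measurable hAm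
    have hΦinv : ∀ y, Φ T (Φ (-T) y) = y := by
      intro y
      have h1 := hflow_add T (-T) y
      rw [add_neg_cancel] at h1
      rw [← h1]; exact ODE.evolutionMap_self _ 0 y
    have hΦinv' : ∀ z, Φ (-T) (Φ T z) = z := by
      intro z
      have h1 := hflow_add (-T) T z
      rw [neg_add_cancel] at h1
      rw [← h1]; exact ODE.evolutionMap_self _ 0 z
    have hB'eq : ∀ z, z ∈ B' ↔ ∃ y ∈ A, z = Φ (-T) y := by
      intro z
      constructor
      · intro hz; exact ⟨Φ T z, hz, (hΦinv' z).symm⟩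
      · rintro ⟨y, hy, rfl⟩
        show Φ T (Φ (-T) y) ∈ A
        rw [hΦinv y]; exact hy
    have himage : Φ T '' B' = A := by
      ext y
      constructor
      · rintro ⟨z, hz, rfl⟩; exact hz
      · intro hy; exact ⟨Φ (-T) y, by show Φ T (Φ (-T) y) ∈ A; rw [hΦinv y]; exact hy, hΦinv y⟩
    -- forward orbits of `B'` stay in the ball `‖z‖ ≤ Rbig − 1` on `[0,T]`
    have hstay : ∀ z ∈ B', ∀ σ ∈ Icc 0 T, ‖Φ σ z‖ ≤ Rbig - 1 := by
      intro z hz σ hσ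
      obtain ⟨y, hy, rfl⟩ := (hB'eq z).1 hz
      have h1 : Φ σ (Φ (-T) y) = Φ (-(T - σ)) y := by
        rw [← hflow_add σ (-T) y]; congr 1; ring
      rw [h1]
      obtain ⟨-, hup, -⟩ := horbit y hy (T - σ) ⟨by linarith [hσ.2], by linarith [hσ.1]⟩
      have hyR1 : ‖y‖ ≤ R + 1 := by
        rw [hA, mem_ball] at hy
        have h1 : ‖y‖ - ‖y₀‖ ≤ ‖y - y₀‖ := norm_sub_norm_le y y₀
        rw [← dist_eq_norm] at h1
        linarith
      have h2 : Real.exp (C₁ * (T - σ)) ≤ Real.exp (C₁ * T) :=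
        Real.exp_le_exp.2 (mul_le_mul_of_nonneg_left (by linarith [hσ.1]) (by rw [hC₁]; positivity))
      have h3 : ‖y‖ * Real.exp (C₁ * (T - σ)) ≤ (R + 1) * Real.exp (C₁ * T) :=
        mul_le_mul hyR1 h2 (Real.exp_pos _).le (by linarith)
      rw [hRbig]; linarith
    -- the cut-off field is divergence-free on that ball
    have hdiv : ∀ z : EuclideanSpace ℝ (Fin 3), ‖z‖ ≤ Rbig - 1 → VectorCalculus.divergence V z = 0 := by
      intro z hz
      have hzball : z ∈ ball (0 : EuclideanSpace ℝ (Fin 3)) Rbig := mem_ball_zero_iff.2 (by linarith)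
      have hev : V =ᶠ[𝓝 z] U := by
        filter_upwards [isOpen_ball.mem_nhds hzball] with w hw using hVU w hw
      unfold VectorCalculus.divergence
      rw [hev.fderiv_eq]
      exact hprof.divFree z
    -- the volume law: `vol A = e^{3γT} vol B'`
    have hvol : volume A = ENNReal.ofReal (Real.exp (3 * γ * T)) * volume B' := by
      rw [← himage]
      exact volume_image_flow_eq_exp_of_stay (γ := γ) hV2 hK hT hdiv hB'm hstay
    -- `B'` sits in the far high set
    have hB'sub : B' ⊆ {z | h < Hb z} ∩ {z | (R - 1) * Real.exp (c₁ * T) ≤ ‖z‖} := by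
      intro z hz
      obtain ⟨y, hy, rfl⟩ := (hB'eq z).1 hz
      obtain ⟨hlow, -, hH⟩ := horbit y hy T ⟨hT, le_rfl⟩
      refine ⟨hH, ?_⟩
      show (R - 1) * Real.exp (c₁ * T) ≤ ‖Φ (-T) y‖
      exact (mul_le_mul_of_nonneg_right (hAR y hy).le (Real.exp_pos _).le).trans hlow
    have hfarR : R₂ ≤ (R - 1) * Real.exp (c₁ * T) := by
      have h1 : 1 ≤ Real.exp (c₁ * T) := Real.one_le_exp (by positivity)
      nlinarith
    have hB'vol : volume B' ≤ ENNReal.ofReal (C' * ((R - 1) * Real.exp (c₁ * T)) ^ (-m)) :=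
      (measure_mono hB'sub).trans (hthinR' _ hfarR)
    -- conclusion of the squeeze
    calc volume A = ENNReal.ofReal (Real.exp (3 * γ * T)) * volume B' := hvol
      _ ≤ ENNReal.ofReal (Real.exp (3 * γ * T)) * ENNReal.ofReal (C' * ((R - 1) * Real.exp (c₁ * T)) ^ (-m)) :=
          mul_le_mul' le_rfl hB'vol
      _ = ENNReal.ofReal (C' * (R - 1) ^ (-m) * Real.exp ((3 * γ - c₁ * m) * T)) := by
          rw [← ENNReal.ofReal_mul (Real.exp_pos _).le]
          congr 1
          have := rpow_mul_exp_neg_mul_exp (c₁ := c₁) (m := m) (γ := γ) (T := T) hR0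
          calc Real.exp (3 * γ * T) * (C' * ((R - 1) * Real.exp (c₁ * T)) ^ (-m))
              = C' * (Real.exp (3 * γ * T) * ((R - 1) * Real.exp (c₁ * T)) ^ (-m)) := by ring
            _ = C' * ((R - 1) ^ (-m) * Real.exp ((3 * γ - c₁ * m) * T)) := by rw [this]
            _ = C' * (R - 1) ^ (-m) * Real.exp ((3 * γ - c₁ * m) * T) := by ring
  -- ### `vol A = 0`: absurd
  have hδ : 0 < c₁ * m - 3 * γ := by linarith
  have hA0 : volume A = 0 := by
    by_contra hne
    have hvpos : 0 < (volume A).toReal := ENNReal.toReal_pos hne hAtop.ne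
    obtain ⟨T, hT0, hT⟩ := exists_mul_exp_neg_lt (K := C' * (R - 1) ^ (-m)) hδ hvpos
    have h1 := hsqueeze T hT0
    have h2 : C' * (R - 1) ^ (-m) * Real.exp ((3 * γ - c₁ * m) * T) < (volume A).toReal := by
      have : (3 * γ - c₁ * m) * T = -((c₁ * m - 3 * γ) * T) := by ring
      rw [this]; exact hT
    have h3 : volume A < volume A :=
      lt_of_le_of_lt h1 ((ENNReal.ofReal_lt_ofReal_iff hvpos).2 h2 |>.trans_le (ENNReal.ofReal_toReal hAtop.ne).le)
    exact lt_irrefl _ h3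
  exact absurd hA0 hApos.ne'

end Summit.NavierStokesRegularity.NavierStokesRegularity.Theorems.PowerGaugeEulerLiouville.Loc

end
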